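import Summits.ResolutionOfSingularities.ResolutionOfSingularities.Theorems.FrobeniusLadderFRationalResolutionFixedStratumBlowupPoints
import HarnessLib

/-!
# Crux `FrobeniusLadder.FRationalResolution` (stmt-ResolutionOfSingularities-15317), line `redirect`,
# stub `stub_diagonalizableQuotientResolution` — **the points of the blow-up along a GIVEN chain, over a stratum point**
# (design C3 = the rank-2 stratum layer of the non-isolated case, memo MEMO-15317-leafhand2-g10 §2 (L3-b):
# `…FixedStratumBlowupPoints.stalk_regular_or_fixedPrime_of_stratum` chooses its chain `s` by `∃`; the global round
# `X ↦ Bl_{𝓘_{Sing X}} X` pulls back ONE centre `(χ(s))` which must be read at EVERY point of the stratum, so here the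
# chain `s` — with exactly the chart property delivered by `…ConeChainCharts.round_charts` — is an INPUT)

RESULT **`stalk_regular_or_fixedPrime_of_chain`**: for a cone chart algebra `(C, Q, χ)` over a base `(A, P, φ, 𝔭)` log regular
along the stratum of `𝔭` with `n − rk F_𝔭 ≤ 2`, and a finite `s ⊆ Q` whose blow-up chart monoids are vertex cones with
parameters `c ≤ 1 ∨ c + 2 ≤ d`, every point `p'` of `affineBlowup (χ(s))` over `𝔭` has a regular local ring, or is the
image of a prime of a chart `C_h`, `h ∈ s`, `2 ≤ c ≤ d − 2`, over `𝔭` containing `χ_h(Q_h ∖ ℤF_𝔭)`, which is SINGULAR.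
Proof verbatim as in `…FixedStratumBlowupPoints` after the choice of the chain.

Honest label: assembly toward ONE leaf stub (no stub, crux or summit closed). No definitions, no named facts, no
sorry. [cite: Kato1994, (7.3), (10.1), (10.3)] [cite: GortzWedhorn2020, (13.19) p. 415]
-/


noncomputable section

-- single-problem summit: the doubled namespace component is forced
set_option linter.dupNamespace false

open CategoryTheory AlgebraicGeometry TopologicalSpace
open IsLocalRing Literature.AlgebraicGeometry.Resolution Literature.AlgebraicGeometry.Resolution.LogChart
open Summit.ResolutionOfSingularities.ResolutionOfSingularities.Theorems.FRationalResolution.ConeChainCharts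
open Summit.ResolutionOfSingularities.ResolutionOfSingularities.Theorems.FRationalResolution.ConeChartNextRound
open Summit.ResolutionOfSingularities.ResolutionOfSingularities.Theorems.FRationalResolution.BlowupChartPoints
open Summit.ResolutionOfSingularities.ResolutionOfSingularities.Theorems.FRationalResolution.FixedStratumNextRound

namespace Summit.ResolutionOfSingularities.ResolutionOfSingularities.Theorems.FRationalResolution.FixedStratumBlowupPointsChain

universe u

set_option maxHeartbeats 400000 in
/-- **The points of `Bl_{(χ s)}(Spec C)` over a stratum point, for a GIVEN chain `s`** (the chain is an input with the
properties produced by `…ConeChainCharts.round_charts`, so that ONE global centre can be read at every point of the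
stratum): every point over `𝔭` is regular or the image of a SINGULAR fixed prime with parameter `2 ≤ c ≤ d − 2`.
[cite: Kato1994, (7.3), (10.1), (10.3)] [cite: GortzWedhorn2020, (13.19) p. 415] -/
theorem stalk_regular_or_fixedPrime_of_chain {A : Type} [CommRing A] [IsNoetherianRing A] {n : ℕ}
    {P : AddSubmonoid (Fin n → ℤ)} {φ : Multiplicative P →* A} {𝔭 : Ideal A} [𝔭.IsPrime]
    {C : Type} [CommRing C] [Algebra A C] [IsNoetherianRing C] {Q : AddSubmonoid (Fin n → ℤ)}
    {χ : Multiplicative Q →* C} {u e : Fin n → ℤ} {d : ℕ} (hP : P.FG)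
    (hsat : ∀ (w : Fin n → ℤ) (k : ℕ), 0 < k → k • w ∈ P → w ∈ P)
    (hspanP : Submodule.span ℤ (P : Set (Fin n → ℤ)) = ⊤) (hreg : IsLogRegularAt P φ 𝔭) (hPQ : P ≤ Q)
    (hχ : ∀ p : P, χ (Multiplicative.ofAdd ⟨(p : Fin n → ℤ), hPQ p.2⟩) =
      algebraMap A C (φ (Multiplicative.ofAdd p)))
    (hgen : Algebra.adjoin A (Set.range χ) = ⊤)
    (hD : ∀ q ∈ Q, ∃ p ∈ P, q + p ∈ P)
    (hK : ∀ a : A, algebraMap A C a = 0 → ∃ p : P, φ (Multiplicative.ofAdd p) * a = 0)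
    (hΩ : ∀ (K : Type) [Field K] (g : A →+* K), (∀ p : P, g (φ (Multiplicative.ofAdd p)) ≠ 0) →
      ∃ ω : C →+* K, ω.comp (algebraMap A C) = g)
    (hQfg : Q.FG)
    (hspan : ∀ w : Fin n → ℤ, ∃ g ∈ Submodule.span ℤ (faceMonoid P φ 𝔭 : Set (Fin n → ℤ)),
      ∃ m l : ℤ, w = g + m • u + l • e)
    (hreg' : ∀ (𝔮 : Ideal A) [𝔮.IsPrime], 𝔮 ≤ 𝔭 → ideal P φ 𝔭 ≤ 𝔮 → IsLogRegularAt P φ 𝔮)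
    (hrank : n - Module.finrank ℤ (Submodule.span ℤ (faceMonoid P φ 𝔭 : Set (Fin n → ℤ))) ≤ 2)
    {s : Set (Fin n → ℤ)} (hsfin : s.Finite)
    (hchart : ∀ (h : Fin n → ℤ) (hhQ : h ∈ Q), h ∈ s → ∃ v x : Fin n → ℤ, ∃ c : ℕ, (c ≤ 1 ∨ c + 2 ≤ d) ∧
      (∀ g ∈ Submodule.span ℤ (faceMonoid P φ 𝔭 : Set (Fin n → ℤ)), ∀ m l : ℤ,
        g + m • v + l • x = 0 → m = 0 ∧ l = 0) ∧
      (∀ w : Fin n → ℤ, (∃ g ∈ Submodule.span ℤ (faceMonoid P φ 𝔭 : Set (Fin n → ℤ)), ∃ m l : ℤ,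
        w = g + m • u + l • e) →
        ∃ g ∈ Submodule.span ℤ (faceMonoid P φ 𝔭 : Set (Fin n → ℤ)), ∃ m l : ℤ, w = g + m • v + l • x) ∧
      ∀ w, w ∈ blowupChartMonoid Q {q : Q | (q : Fin n → ℤ) ∈ s} ⟨h, hhQ⟩ ↔
        ∃ g ∈ Submodule.span ℤ (faceMonoid P φ 𝔭 : Set (Fin n → ℤ)), ∃ m l : ℤ,
          0 ≤ m ∧ 0 ≤ m + (c : ℤ) * l ∧ w = g + m • v + l • x) :
      ∀ p' : affineBlowup (Ideal.span ((fun q : Q => χ (Multiplicative.ofAdd q)) '' {q : Q | (q : Fin n → ℤ) ∈ s})),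
        ((affineBlowup.π _ p').asIdeal.comap (algebraMap A C) = 𝔭) →
        IsRegularLocalRing ((affineBlowup (Ideal.span ((fun q : Q => χ (Multiplicative.ofAdd q)) ''
          {q : Q | (q : Fin n → ℤ) ∈ s}))).presheaf.stalk p') ∨
        ∃ (h : Fin n → ℤ) (hhQ : h ∈ Q) (hhs : h ∈ s) (v x : Fin n → ℤ) (c : ℕ), 2 ≤ c ∧ c + 2 ≤ d ∧
          (∀ w, w ∈ blowupChartMonoid Q {q : Q | (q : Fin n → ℤ) ∈ s} ⟨h, hhQ⟩ ↔
            ∃ g ∈ Submodule.span ℤ (faceMonoid P φ 𝔭 : Set (Fin n → ℤ)), ∃ m l : ℤ,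
              0 ≤ m ∧ 0 ≤ m + (c : ℤ) * l ∧ w = g + m • v + l • x) ∧
          (∀ g ∈ Submodule.span ℤ (faceMonoid P φ 𝔭 : Set (Fin n → ℤ)), ∀ m l : ℤ,
            g + m • v + l • x = 0 → m = 0 ∧ l = 0) ∧
          (∀ w : Fin n → ℤ, ∃ g ∈ Submodule.span ℤ (faceMonoid P φ 𝔭 : Set (Fin n → ℤ)),
            ∃ m l : ℤ, w = g + m • v + l • x) ∧
          ∃ (q : Spec (.of (HomogeneousLocalization.Away (reesGrading (Ideal.span ((fun q : Q => χ (Multiplicative.ofAdd q)) '' {q : Q | (q : Fin n → ℤ) ∈ s}))) (reesT (χ (Multiplicative.ofAdd ⟨h, hhQ⟩)) (Ideal.subset_span (Set.mem_image_of_mem (fun q : Q => χ (Multiplicative.ofAdd q)) (show (⟨h, hhQ⟩ : Q) ∈ {q : Q | (q : Fin n → ℤ) ∈ s} from hhs)))))))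
            (𝔔 : Ideal (blowupAlgebra (Ideal.span ((fun q : Q => χ (Multiplicative.ofAdd q)) '' {q : Q | (q : Fin n → ℤ) ∈ s})) (χ (Multiplicative.ofAdd ⟨h, hhQ⟩)))) (_ : 𝔔.IsPrime),
            Proj.awayι (reesGrading (Ideal.span ((fun q : Q => χ (Multiplicative.ofAdd q)) '' {q : Q | (q : Fin n → ℤ) ∈ s}))) (reesT (χ (Multiplicative.ofAdd ⟨h, hhQ⟩)) (Ideal.subset_span (Set.mem_image_of_mem (fun q : Q => χ (Multiplicative.ofAdd q)) (show (⟨h, hhQ⟩ : Q) ∈ {q : Q | (q : Fin n → ℤ) ∈ s} from hhs)))) (reesT_mem (χ (Multiplicative.ofAdd ⟨h, hhQ⟩)) (Ideal.subset_span (Set.mem_image_of_mem (fun q : Q => χ (Multiplicative.ofAdd q)) (show (⟨h, hhQ⟩ : Q) ∈ {q : Q | (q : Fin n → ℤ) ∈ s} from hhs)))) one_pos q = p' ∧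
            (∀ t, t ∈ q.asIdeal ↔ reesChartEquiv (I := (Ideal.span ((fun q : Q => χ (Multiplicative.ofAdd q)) '' {q : Q | (q : Fin n → ℤ) ∈ s}))) (χ (Multiplicative.ofAdd ⟨h, hhQ⟩)) (Ideal.subset_span (Set.mem_image_of_mem (fun q : Q => χ (Multiplicative.ofAdd q)) (show (⟨h, hhQ⟩ : Q) ∈ {q : Q | (q : Fin n → ℤ) ∈ s} from hhs))) t ∈ 𝔔) ∧
            𝔔.comap (algebraMap A _) = 𝔭 ∧
            (∀ qq : blowupChartMonoid Q {q : Q | (q : Fin n → ℤ) ∈ s} ⟨h, hhQ⟩,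
              (qq : Fin n → ℤ) ∉ Submodule.span ℤ (faceMonoid P φ 𝔭 : Set (Fin n → ℤ)) →
                blowupChart Q χ {q : Q | (q : Fin n → ℤ) ∈ s} ⟨h, hhQ⟩ (Multiplicative.ofAdd qq) ∈ 𝔔) ∧
            ¬ IsRegularLocalRing (Localization.AtPrime 𝔔) := by
  classical
  intro p' hp'
  -- the generating family of `J = (χ s)` indexed by `S`
  let xg : {q : Q | (q : Fin n → ℤ) ∈ s} → C := fun q => χ (Multiplicative.ofAdd (q : Q))
  have hxJ : ∀ i : {q : Q | (q : Fin n → ℤ) ∈ s}, xg i ∈ (Ideal.span ((fun q : Q => χ (Multiplicative.ofAdd q)) '' {q : Q | (q : Fin n → ℤ) ∈ s})) :=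
    fun i => Ideal.subset_span ⟨i.1, i.2, rfl⟩
  have hJle : (Ideal.span ((fun q : Q => χ (Multiplicative.ofAdd q)) '' {q : Q | (q : Fin n → ℤ) ∈ s})) ≤ Ideal.span (Set.range xg) := by
    refine Ideal.span_le.2 ?_
    rintro _ ⟨q, hq, rfl⟩
    exact Ideal.subset_span ⟨⟨q, hq⟩, rfl⟩
  obtain ⟨⟨⟨h, hhQ⟩, hhs⟩, q, 𝔔, h𝔔, hpq, hmemq, hcomap, hregiff⟩ :=
    exists_chart_point_prime (Ideal.span ((fun q : Q => χ (Multiplicative.ofAdd q)) '' {q : Q | (q : Fin n → ℤ) ∈ s})) xg hxJ hJle p'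
  -- `𝔔` lies over `𝔭`
  have h𝔔A : 𝔔.comap (algebraMap A _) = 𝔭 := by
    rw [IsScalarTower.algebraMap_eq A C, ← Ideal.comap_comap, hcomap]; exact hp'
  -- the vertex data of the chart at `h`
  have hhs' : (h : Fin n → ℤ) ∈ s := hhs
  obtain ⟨v, x, c, hcd, hindvx, hspanvx, hQh⟩ := hchart h hhQ hhs'
  have hspanvx' : ∀ w : Fin n → ℤ, ∃ g ∈ Submodule.span ℤ (faceMonoid P φ 𝔭 : Set (Fin n → ℤ)),
      ∃ m l : ℤ, w = g + m • v + l • x := fun w => hspanvx w (hspan w)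
  rcases Nat.lt_or_ge c 2 with hc | hc
  · -- `c ≤ 1`: every prime over `𝔭` is regular
    left
    rw [hregiff]
    exact isRegularLocalRing_chart_of_param_le_one (by omega) hP hsat hspanP hPQ hχ hgen hD hK hΩ hreg hhQ hQh
      hindvx hspanvx' 𝔔 h𝔔A
  · -- `c ≥ 2`: regular unless `𝔔` is the fixed prime
    obtain ⟨𝔓h, h𝔓hprime, h𝔓hA, h𝔓hq, -, hsing, hregother, -⟩ := exists_fixedPrime_package_of_stratum hc hsfin hP
      hsat hspanP hreg hreg' hrank hPQ hχ hgen hD hK hΩ hQfg hhQ hQh hindvx hspanvx'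
    by_cases hne : 𝔔 = 𝔓h
    · right
      subst hne
      refine ⟨h, hhQ, hhs', v, x, c, hc, ?_, hQh, hindvx, hspanvx', q, 𝔔, h𝔔, hpq, hmemq, h𝔔A,
        fun qq hqq => (h𝔓hq qq).2 hqq, hsing⟩
      rcases hcd with hcd | hcd
      · omega
      · exact hcd
    · left
      rw [hregiff]
      exact hregother 𝔔 h𝔔A hne

end Summit.ResolutionOfSingularities.ResolutionOfSingularities.Theorems.FRationalResolution.FixedStratumBlowupPointsChain

end
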